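import Summits.QuantumFields.BalabanUV.Beta.RoadP2Chain
import Summits.QuantumFields.BalabanUV.Beta.CutoffVariant316

/-!
# Beta / VariantCutoffRoad — BINDER-OWNERS row D4, co-owner road P2″ «[II] Lemma 3 at the [III] (3.16) cut-off»:
# the ω-form of the (D4) binder from the ROW OWNER'S LEAF LIST VERBATIM, read at the substituted smallness
# `ε₁ ↦ δ(g_k) := g_k·r(g_k) = A₁ g_k (log g_k⁻²)^{p₀}` — no t·g_k interpolation, no marked polymer, no cut-off node, no N3
# (β sub-cell, unit `b2b-balaban-beta-d4-p2`, generation 2; `HOME/beta/skeletons/D4-b2b-balaban-beta-d4-p2.md` v2 §1–§3)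

HONEST FRAMING (page 1 of everything the β sub-cell writes): discharging `BetaPertH` makes Bałaban's UV stability
UNCONDITIONAL — a real constructive-QFT result; it is NOT the continuum limit and NOT the Clay problem.  HONEST DEPENDENCY
(cell reorg 2026-08-19, verbatim): «continuum YM on T⁴ ⇐ BetaPertH ∧ nine spine estimates (0/9 proved); BetaPertH ⇐ (D1) ∧
(D4) ∧ CAP+tail; G-an2-4 gates asym, D1 and NE2/3/4.»  THIS MODULE INSTANTIATES NO BINDER AND ASSERTS NOTHING ABOUT
BAŁABAN'S β-FUNCTIONS: every declaration is a definition, a HYPOTHESIS STRUCTURE (displayed hypotheses, never facts), or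
a theorem proved from the UNMODIFIED modules `Beta.RemainderChainTorus` (row owner an4), `RoadP2Chain` and
`CutoffVariant316` (this unit, gen 1), imported BY NAME.

ABSOLUTE RULE (cell charter, verbatim): "No internally-minted statement may enter as a cited fact. Every hypothesis is
either kernel-proved in this package or a verbatim quotation of a PUBLISHED theorem with page reference. The manuscript(s)
under audit are NOT citable for their own disputed steps — they are the thing under adjudication; programme-internal
(2001/route/tribunal) claims are never citable."  Nothing is cited as a fact here.

## The reading behind road P2″ (ε₁-provenance in [II]; audit `HOME/b2b-balaban-beta-d4-p2/AUDIT-EPS1-PROVENANCE.md`)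

In [Balaban1988RG2Cluster] (= [II]) EVERY occurrence of the constant ε₁ in Lemma 1 (1.36) p. 9, Lemma 2 (1.43) p. 11 and
Lemma 3 (2.18), (2.26), (2.28), (2.33), (2.35), (2.37), (2.38) pp. 16–20 is PRINTED as the majorant of `g_k|B|` over the
small-field box `{B : |B| < ε₁g_k⁻¹ on Y}` of (1.34) — explicitly: (1.20) p. 6 «|B′| ≤ O(1)g_k|B| + 4C₂(O(1)g_k|B|)² ≤
C₁g_k|B| < C₁ε₁», (1.21) p. 7 «|𝐇_k(s(Y₀),B′)| ≤ 4B₀C₁e^{16κ₁}g_k|B| < 4B₀C₁e^{16κ₁}ε₁», (1.22) «1/|t_□| =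
8B₀C₁e^{16κ₁}α₂⁻¹g_k|B| < 8B₀C₁e^{16κ₁}α₂⁻¹ε₁», (1.24) (the factor g_k|B| printed), p. 8 ll. 20–22 «Another possibility
is to use the expression g_k|B| instead of ε₁. It gives a better bound, but the above is simpler.», p. 11 l. 1 «|B′|
replaced by C₁ε₁»; and every `ε₁²/g_k²` of (2.22), (2.31), (2.33), (2.34), R16 p. 18 is the SQUARED CUT-OFF THRESHOLD of
(2.3) p. 12.  Consequently, in the construction VARIANT of this unit's road (cell DIVERGENCE D-d4p2-1: [I]/[II]'s
small-field step with ABSOLUTE analyticity radii α₀, α₁, α₂, the fluctuation cut-off of (2.3) replaced by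
[Balaban1988Convergent] (= [III]) (3.16) p. 268, `|B(b)| < r_k := A₁(log g_k⁻²)^{p₀}` — inside [II]'s box as soon as
`g_k r_k ≤ ε₁`, `CutoffVariant316.mul_p0Profile_le_of_le_gammaC`), every one of those displays holds with
`ε₁ ↦ δ_k := g_k r_k` and `ε₁²g_k⁻² ↦ r_k²`, and Lemma 3 reads  |H(Z)| ≤ C₃·δ_k·exp(−(1 − 8δ)½Lκ d_{k+1}(Z))  — the row
owner's field `h238 : B13.Bound238With … c ℓ` at the constants record `withEps c (deltaOf A₁ p₀ g_k)`.  `δ_k` is [III]'s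
own `δ_k = A₁g_k(log g_k⁻²)^{p₀}` ((1.1)/(1.4) p. 246, (3.4) p. 265; tree `Setup.epsK`: `epsK_eq_deltaOf`).

WHAT THIS BUYS (kernel, below): the ω-form `|β¹_{k+1}(g_0,…,g_k)| ≤ δ(g_k)·K_rem,L` with THE ROW OWNER'S OWN coefficient
`K_rem,L = RemainderChainLattice.remCoeffL d M c α₂ B₃` (`ChainTδ.abs_beta1_le`; compare the owner's constant form
`ChainT.abs_beta1_le : RemainderConst S γ (ε₁ · remCoeffL d M c α₂ B₃)`), and the wall END with NO `r ≤ b` hypothesis and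
NO restriction of the N3 type (`endpointExistence_of_chainTδ`): the threshold is met by γ, last in the printed order of
constants ([Balaban1987RG1] Thm 3 p. 264 «The constant γ depends on all other constants.»).  Every [II]-side use of ε₁ as
a SMALLNESS becomes a γ-clause (`kpCoeff d c · δ(γ₀) ≤ 1` = the owner's `CondsL.small` at the substituted constants;
R15/R16/R23 likewise, `CutoffVariant316.R16_variant`); ε₁ survives only as [II]'s DOMAIN size ((1.34), «e^{32κ₁}ε₁
smaller than an absolute constant» p. 7, «4B₀C₁e^{16κ₁}ε₁ ≤ ¼α₂» p. 7), untouched.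

WHAT STAYS LOCATED (unchanged — this road adds NO leaf to road P1's): NODE O (Bałaban's small-field step objects, now
with the (3.16) cut-off — XL, unowned); the apex = [II] Lemma 3 ITSELF (road P1's NODE A: (T1) G-B13-05a ⇐ (T2) G-IF-10 ⇐
(T3) G-B9-10 [MEDIUM], (T4) columns, (T5)/(T6) LOW), whose printed proof pp. 12–20 is READ at the substituted constants
display by display (the audit lists each display and its class); NODE B ([I] (4.4) seam); the [model] dictionary (T12);
the [variant] clause D-d4p2-1 (which β the wall means).  NOT CLAIMED: any instance of `ChainTδ` for Bałaban's
construction; anything of `BetaPertH`; NOT continuum, NOT Clay, NOT summit progress.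
-/

namespace Summit.QuantumFields.BalabanUV.Beta.VariantCutoffRoad

open Literature.MathematicalPhysics.QuantumFieldTheory.Balaban1983to89
open FlowStep DagBinding FlowStepRuns
open Literature.MathematicalPhysics.QuantumFieldTheory.Balaban1983to89.B12TreeDecay (kappa₀ K₀ K₀_pos)
open Literature.MathematicalPhysics.QuantumFieldTheory.Balaban1983to89.TreeLengthTorus (torusTreeLen)
open Literature.MathematicalPhysics.QuantumFieldTheory.Balaban1983to89.B12Decay510Window (K₁ K₁_nonneg)
open Literature.MathematicalPhysics.QuantumFieldTheory.Balaban1983to89.Beta.RemainderChain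
  (RemainderConst remActivity polConst polConst_nonneg)
open Literature.MathematicalPhysics.QuantumFieldTheory.Balaban1983to89.Beta.RemainderChainTorus (PolLeavesT)
open Literature.MathematicalPhysics.QuantumFieldTheory.Balaban1983to89.Beta.RemainderChainLattice
  (CondsL remCoeffL polConstL deltaL polConstL_nonneg)
open Literature.MathematicalPhysics.QuantumFieldTheory.Balaban1983to89.Beta.Drift (OneLoopDrift)
open Summit.QuantumFields.BalabanUV.Beta.RoadP2Chain
open Summit.QuantumFields.BalabanUV.Beta.CutoffVariant316
open Metric Filter Topology Set

noncomputable section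

variable {d : ℕ}

/-! ## §1 The constants record at a substituted smallness, and what does NOT depend on ε₁ -/

/-- [II]'s constants record with the smallness slot `ε₁` REPLACED by `ε` (all other letters — L, q, M, κ, κ₁, δ, δ₀, E₀,
C₁, C₂, C₃, α's, γ₂, γ, A₁, A₂ — untouched).  On road P2″ the slot is read at `ε := δ(g_k) = g_k·r(g_k)`. -/
def withEps (c : B13.Consts) (ε : ℝ) : B13.Consts := { c with ε₁ := ε }

/-- The substituted slot. -/
@[simp] theorem withEps_eps1 (c : B13.Consts) (ε : ℝ) : (withEps c ε).ε₁ = ε := rfl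

/-- Lemma 3's constant `C₃ = 2(L+2)⁴O(1)·2E₀C₁α₄⁻¹α₆⁻¹M^q e^{C₂κ₁}` (p. 20) does not contain ε₁. -/
theorem C3act_withEps (c : B13.Consts) (ε : ℝ) : (withEps c ε).C3act = c.C3act := rfl

/-- The activity `A_rem = O(1)·C₃·ε₁` of (2.41) at the substituted slot is `O(1)·C₃·ε`. -/
theorem remActivity_withEps (c : B13.Consts) (ε : ℝ) : remActivity (withEps c ε) = c.A₂ * c.C3act * ε := rfl

/-- The row owner's remainder coefficient `K_rem,L` is ε₁-FREE: it is the same number at every substituted slot. -/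
theorem remCoeffL_withEps (d M : ℕ) (c : B13.Consts) (ε : ℝ) (α₂ B₃ : ℝ) :
    remCoeffL d M (withEps c ε) α₂ B₃ = remCoeffL d M c α₂ B₃ := rfl

/-- The closing condition `(1 − 10δ)ℓ = 1` (R22) does not contain ε₁. -/
theorem R22gen_withEps (c : B13.Consts) (ε : ℝ) (ℓ : ℝ) : (withEps c ε).R22gen ℓ ↔ c.R22gen ℓ := Iff.rfl

/-- The three ε₁-FREE members of the owner's four numeric conditions `RemainderChainLattice.CondsL d c ℓ`: `large`
(κ-largeness in Kotecký–Preiss form), `A₂` (the O(1) of (2.41)), `tree` ([I]'s domain-sum rate).  The fourth member,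
`small` («ε₁ sufficiently small», [II] p. 21), is the one that becomes a γ-clause on road P2″ (`condsL_withEps`). -/
structure CondsL0 (d : ℕ) (c : B13.Consts) (ℓ : ℝ) : Prop where
  large : c.κ + 2 * kappa₀ (4 * 2 ^ d) (2 * d) + 2 ≤ (1 - 8 * c.δ) * ℓ * c.κ
  A₂ : Real.exp 1 * (2 * (d : ℝ) + 1) * (4 * 2 ^ d) * K₀ (4 * 2 ^ d) (2 * d) ^ 2 ≤ c.A₂
  tree : kappa₀ (4 * 2 ^ d) (2 * d) ≤ c.κ / 2

/-- The owner's `CondsL` contains `CondsL0`. -/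
theorem CondsL0.of_condsL {c : B13.Consts} {ℓ : ℝ} (h : CondsL d c ℓ) : CondsL0 d c ℓ := ⟨h.large, h.A₂, h.tree⟩

/-- `A₂ ≥ 0` from the `A₂` condition. -/
theorem CondsL0.A₂_nonneg {c : B13.Consts} {ℓ : ℝ} (h : CondsL0 d c ℓ) : 0 ≤ c.A₂ :=
  le_trans (by positivity) h.A₂

/-- `κ > 0` from the `tree` condition. -/
theorem CondsL0.kappa_pos {c : B13.Consts} {ℓ : ℝ} (h : CondsL0 d c ℓ) : 0 < c.κ := by
  have := Beta.RemainderChainLattice.kappa₀_pos (c₀ := 4 * 2 ^ d) (by positivity) (2 * d)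
  linarith [h.tree]

/-- The ε₁-free coefficient of the Kotecký–Preiss smallness: `CondsL.small` reads `kpCoeff d c · ε₁ ≤ 1`. -/
def kpCoeff (d : ℕ) (c : B13.Consts) : ℝ :=
  c.C3act * Real.exp (5 * c.κ + 1) * K₀ (4 * 2 ^ d) (2 * d) * (2 * (d : ℝ) + 1) * (4 * 2 ^ d)

/-- `kpCoeff ≥ 0` once `C₃ ≥ 0`. -/
theorem kpCoeff_nonneg {c : B13.Consts} (hC3 : 0 ≤ c.C3act) : 0 ≤ kpCoeff d c := by
  unfold kpCoeff
  have := K₀_pos (4 * 2 ^ d) (2 * d)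
  positivity

/-- **`CondsL` AT A SUBSTITUTED SLOT**: the three ε₁-free conditions plus the smallness `kpCoeff d c · ε ≤ 1` give the
owner's four conditions for the record `withEps c ε`. -/
theorem condsL_withEps {c : B13.Consts} {ℓ ε : ℝ} (h0 : CondsL0 d c ℓ) (hsmall : kpCoeff d c * ε ≤ 1) :
    CondsL d (withEps c ε) ℓ := by
  refine ⟨h0.large, ?_, h0.A₂, h0.tree⟩
  have key : (withEps c ε).C3act * (withEps c ε).ε₁ * Real.exp (5 * (withEps c ε).κ + 1) * K₀ (4 * 2 ^ d) (2 * d) *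
      (2 * (d : ℝ) + 1) * (4 * 2 ^ d) = kpCoeff d c * ε := by
    rw [C3act_withEps, withEps_eps1]
    show c.C3act * ε * Real.exp (5 * c.κ + 1) * K₀ (4 * 2 ^ d) (2 * d) * (2 * (d : ℝ) + 1) * (4 * 2 ^ d) =
      kpCoeff d c * ε
    unfold kpCoeff; ring
  rw [key]; exact hsmall

/-! ## §2 The substituted smallness `δ(g) = g·r(g)`, `r(g) = A₁(log g⁻²)^{p₀}` — [III]'s own `δ_k` -/

/-- `δ(g) := g · r(g)`, `r = p0Profile A₁ p₀` — the size of the scaled fluctuation field `g_k|B|` on the (3.16) cut-off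
box; [III] (1.1)/(1.4) p. 246's `δ_k = A₁ g_k (log g_k⁻²)^{p₀}`. -/
def deltaOf (A₁ : ℝ) (p₀ : ℕ) (g : ℝ) : ℝ := g * p0Profile A₁ p₀ g

/-- Dictionary with the tree: along a flow, `Setup.epsK A p₀ F k` IS `deltaOf A p₀ (g_k)`. -/
theorem epsK_eq_deltaOf (A : ℝ) (p₀ : ℕ) (F : Flow) (k : ℕ) : epsK A p₀ F k = deltaOf A p₀ (F.g k) := rfl

/-- `δ(g) = A₁ · (g · x(g)^{p₀})`, `x(g) = log g⁻²`. -/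
theorem deltaOf_eq (A₁ : ℝ) (p₀ : ℕ) (g : ℝ) : deltaOf A₁ p₀ g = A₁ * (g * xOf g ^ p₀) := by
  unfold deltaOf; rw [p0Profile_eq_xOf]; ring

/-- `δ` IS the gen-1 budget with `c_I = c_χ = 0`, `c_E = 1` (the insertion's cubic term and the separate cut-off term
of road P2′ are absent on road P2″). -/
theorem deltaOf_eq_budget (A₁ lam : ℝ) (p₀ : ℕ) (g : ℝ) : deltaOf A₁ p₀ g = budget 0 1 0 lam A₁ p₀ g := by
  unfold deltaOf budget; ring

/-- `δ ≥ 0` on `]0,1]` (A₁ ≥ 0). -/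
theorem deltaOf_nonneg {A₁ : ℝ} (hA₁ : 0 ≤ A₁) (p₀ : ℕ) {g : ℝ} (hg : 0 < g) (hg1 : g ≤ 1) :
    0 ≤ deltaOf A₁ p₀ g :=
  mul_nonneg hg.le (p0Profile_nonneg hA₁ p₀ hg hg1)

/-- `e^{−p₀} ≤ 1`. -/
theorem exp_neg_le_one (p₀ : ℕ) : Real.exp (-(p₀ : ℝ)) ≤ 1 := (exp_neg_three_le p₀).2

/-- `δ` is monotone in g on `]0, e^{−p₀}]` (A₁ ≥ 0): the supremum of `δ(g_k)` over a history box `]0,γ]^{k+1}`,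
`γ ≤ e^{−p₀}`, is `δ(γ)`. -/
theorem deltaOf_mono {A₁ : ℝ} (hA₁ : 0 ≤ A₁) (p₀ : ℕ) {g g' : ℝ} (hg : 0 < g) (hgg' : g ≤ g')
    (hg' : g' ≤ Real.exp (-(p₀ : ℝ))) : deltaOf A₁ p₀ g ≤ deltaOf A₁ p₀ g' := by
  rw [deltaOf_eq, deltaOf_eq]
  exact mul_le_mul_of_nonneg_left (mul_xOf_pow_mono p₀ hg hgg' hg') hA₁

/-- `MonotoneOn δ ]0,γ]` for `γ ≤ e^{−p₀}`. -/
theorem deltaOf_monotoneOn {A₁ : ℝ} (hA₁ : 0 ≤ A₁) (p₀ : ℕ) {γ : ℝ} (hγ : γ ≤ Real.exp (-(p₀ : ℝ))) :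
    MonotoneOn (deltaOf A₁ p₀) (Ioc 0 γ) :=
  fun _ hg _ hg' hgg' => deltaOf_mono hA₁ p₀ hg.1 hgg' (hg'.2.trans hγ)

/-- **`δ(g) → 0` as `g → 0⁺`** — the (hr) threshold of the wall is met by shrinking γ (`RoadP2Chain.exists_threshold`). -/
theorem tendsto_deltaOf (A₁ : ℝ) (p₀ : ℕ) : Tendsto (deltaOf A₁ p₀) (𝓝[>] (0 : ℝ)) (𝓝 0) := by
  have h := (tendsto_mul_xOf_pow p₀).const_mul A₁
  rw [mul_zero] at h
  exact h.congr fun g => (deltaOf_eq A₁ p₀ g).symm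

/-- **DOMAIN COMPATIBILITY** (every use of ε₁ as a DOMAIN SIZE in [II] holds a fortiori on the variant's box): for
`0 < g ≤ min{1, γ_c(η)}`, `δ(g) ≤ η` — with η := ε₁ this is `g_k r_k ≤ ε₁`, i.e. `{|B| < r_k} ⊂ {|B| < ε₁g_k⁻¹}`
(`CutoffVariant316.mul_p0Profile_le_of_le_gammaC`, threshold `γ_c(η) = (η/(A₁4^{p₀}p₀!))²`). -/
theorem deltaOf_le_of_le_gammaC {A₁ η : ℝ} (hA₁ : 0 < A₁) (hη : 0 < η) (p₀ : ℕ) {g : ℝ} (hg : 0 < g) (hg1 : g ≤ 1)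
    (hgc : g ≤ gammaC η A₁ p₀) : deltaOf A₁ p₀ g ≤ η :=
  mul_p0Profile_le_of_le_gammaC hA₁ hη p₀ hg hg1 hgc

/-- The same as an inclusion of boxes: `r(g) ≤ η / g`. -/
theorem p0Profile_le_div_of_le_gammaC {A₁ η : ℝ} (hA₁ : 0 < A₁) (hη : 0 < η) (p₀ : ℕ) {g : ℝ} (hg : 0 < g)
    (hg1 : g ≤ 1) (hgc : g ≤ gammaC η A₁ p₀) : p0Profile A₁ p₀ g ≤ η / g := by
  rw [le_div_iff₀ hg, mul_comm]
  exact deltaOf_le_of_le_gammaC hA₁ hη p₀ hg hg1 hgc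

/-! ## §3 The row owner's torus leaf list READ AT THE SUBSTITUTED CONSTANTS, per scale and history -/

/-- **THE ROAD-P2″ CHAIN**: for the β-family `β` with one-loop split `S` on the boxes `]0,γ]^{k+1}` — `P1 k p` the
`T ↗ ℤ^d` limit polarization kernel of the (2.13)-half at scale k + 1 and history p, `beta1_eq` the (1.20)/(1.22)
dictionary clause, and `leaves k p hp` = THE ROW OWNER'S TORUS LEAF LIST `RemainderChainTorus.PolLeavesT` VERBATIM
(restriction property of the spaces, the (2.13) representation, LEMMA 3's (2.38)_ℓ `h238`, the [I] (4.4) seam, (4.35),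
p. 282, (5.1)) at the constants record `withEps c (δ(g_k))`, `g_k = p (Fin.last k)`: Lemma 3 is displayed with
`C₃·δ(g_k)` where the owner displays `C₃·ε₁`.  ONE c, ℓ, α₂, B₃, M, A₁, p₀ for all k, p.  A HYPOTHESIS structure; its
instantiation for Bałaban's (variant) objects is road P1's apex read at the substituted constants — nothing of it is
discharged here. -/
structure ChainTδ (d M : ℕ) [NeZero M] (μ ν : Fin d) {β : HBeta} (S : B12Beta.OneLoopSplit β) (γ : ℝ)
    (c : B13.Consts) (ℓ α₂ B₃ A₁ : ℝ) (p₀ : ℕ) where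
  /-- the infinite-volume polarization kernel of the β¹-generating (2.13)-half, per scale and history -/
  P1 : (k : ℕ) → (Fin (k + 1) → ℝ) → B12Beta.Kernel d
  /-- the (1.20)/(1.22) dictionary: β¹ is the second moment of that kernel -/
  beta1_eq : ∀ k p, p ∈ B12Beta.HistBox γ k → S.β1 k p = B12Beta.secondMoment (P1 k p) μ ν
  /-- the owner's torus leaf list with Lemma 3 at smallness `δ(g_k)` -/
  leaves : ∀ k (p : Fin (k + 1) → ℝ), p ∈ B12Beta.HistBox γ k →
    PolLeavesT d M (P1 k p μ ν) (withEps c (deltaOf A₁ p₀ (p (Fin.last k)))) ℓ α₂ B₃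

/-- The hypotheses under which the substituted leaf lists are CONSUMED by the owner's Kotecký–Preiss resummation
(`PolLeavesT.h118`) uniformly in the scale: the three ε₁-free conditions, the closing condition R22, `C₃ ≥ 0`,
`A₁ ≥ 0`, the history box inside `]0, e^{−p₀}]`, and the Kotecký–Preiss smallness AT THE TOP OF THE BOX
`kpCoeff d c · δ(γ) ≤ 1` — the owner's `CondsL.small` «ε₁ sufficiently small» turned into «γ sufficiently small». -/
structure Hyps (d : ℕ) (γ : ℝ) (c : B13.Consts) (ℓ A₁ : ℝ) (p₀ : ℕ) : Prop where
  conds : CondsL0 d c ℓ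
  R22 : c.R22gen ℓ
  C3_nonneg : 0 ≤ c.C3act
  A₁_nonneg : 0 ≤ A₁
  box : γ ≤ Real.exp (-(p₀ : ℝ))
  small : kpCoeff d c * deltaOf A₁ p₀ γ ≤ 1

/-- `γ ≤ 1` under the box hypothesis. -/
theorem Hyps.gamma_le_one {γ : ℝ} {c : B13.Consts} {ℓ A₁ : ℝ} {p₀ : ℕ} (H : Hyps d γ c ℓ A₁ p₀) : γ ≤ 1 :=
  H.box.trans (exp_neg_le_one p₀)

/-- The Kotecký–Preiss smallness at EVERY coupling of the box follows from the one at its top (δ monotone). -/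
theorem Hyps.small_at {γ : ℝ} {c : B13.Consts} {ℓ A₁ : ℝ} {p₀ : ℕ} (H : Hyps d γ c ℓ A₁ p₀) {g : ℝ} (hg : 0 < g)
    (hgγ : g ≤ γ) : kpCoeff d c * deltaOf A₁ p₀ g ≤ 1 :=
  (mul_le_mul_of_nonneg_left (deltaOf_mono H.A₁_nonneg p₀ hg hgγ H.box) (kpCoeff_nonneg H.C3_nonneg)).trans H.small

/-- The owner's four conditions hold at the record `withEps c (δ g)` for every coupling of the box. -/
theorem Hyps.condsL_at {γ : ℝ} {c : B13.Consts} {ℓ A₁ : ℝ} {p₀ : ℕ} (H : Hyps d γ c ℓ A₁ p₀) {g : ℝ} (hg : 0 < g)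
    (hgγ : g ≤ γ) : CondsL d (withEps c (deltaOf A₁ p₀ g)) ℓ :=
  condsL_withEps H.conds (H.small_at hg hgγ)

/-- `C₃·δ(g) ≥ 0` on the box (the owner's sign hypothesis `SignsL.A` at the substituted slot). -/
theorem Hyps.sign_at {γ : ℝ} {c : B13.Consts} {ℓ A₁ : ℝ} {p₀ : ℕ} (H : Hyps d γ c ℓ A₁ p₀) {g : ℝ} (hg : 0 < g)
    (hgγ : g ≤ γ) : 0 ≤ (withEps c (deltaOf A₁ p₀ g)).C3act * (withEps c (deltaOf A₁ p₀ g)).ε₁ := by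
  rw [C3act_withEps, withEps_eps1]
  exact mul_nonneg H.C3_nonneg (deltaOf_nonneg H.A₁_nonneg p₀ hg (hgγ.trans H.gamma_le_one))

/-- **THE SUBSTITUTED LEAF LIST GIVES THIS UNIT'S (I.1.18)-LEVEL TORUS LEAF LIST** with budget
`A_rem(δ(g_k)) = O(1)·C₃·δ(g_k)` and rate κ: the owner's Kotecký–Preiss step `PolLeavesT.h118` ((2.38)_ℓ ⟹ (2.41) ⟹
(I.1.18) on the torus) RUN AT THE RECORD `withEps c (δ(g_k))`, every other leaf carried over verbatim. -/
def ChainTδ.leaves118 {M : ℕ} [NeZero M] {μ ν : Fin d} {β : HBeta} {S : B12Beta.OneLoopSplit β} {γ : ℝ}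
    {c : B13.Consts} {ℓ α₂ B₃ A₁ : ℝ} {p₀ : ℕ} (R : ChainTδ d M μ ν S γ c ℓ α₂ B₃ A₁ p₀)
    (H : Hyps d γ c ℓ A₁ p₀) (k : ℕ) (p : Fin (k + 1) → ℝ) (hp : p ∈ B12Beta.HistBox γ k) :
    PolLeavesT118 d M (R.P1 k p μ ν) (remActivity (withEps c (deltaOf A₁ p₀ (p (Fin.last k))))) c.κ c.δ₀ α₂ B₃ :=
  let Lv := R.leaves k p hp
  letI := Lv.hN
  { N := Lv.N
    hN := Lv.hN
    hNlim := Lv.hNlim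
    Wn := Lv.Wn
    instW := Lv.instW
    instWs := Lv.instWs
    EXn := Lv.EXn
    hn := Lv.hn
    E2n := Lv.E2n
    han := Lv.han
    h118 := fun n => Lv.h118 (H.condsL_at (hp (Fin.last k)).1 (hp (Fin.last k)).2) H.R22
      (H.sign_at (hp (Fin.last k)).1 (hp (Fin.last k)).2) n
    hrepr := Lv.hrepr
    hh := Lv.hh
    hlim := Lv.hlim }

/-- **THE ROAD-P2″ CHAIN IS THIS UNIT'S VARIABLE-BUDGET TORUS CHAIN** (`RoadP2Chain.ChainVarT`) with the budget
`g ↦ A_rem(δ(g)) = O(1)·C₃·δ(g)`. -/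
def ChainTδ.toChainVarT {M : ℕ} [NeZero M] {μ ν : Fin d} {β : HBeta} {S : B12Beta.OneLoopSplit β} {γ : ℝ}
    {c : B13.Consts} {ℓ α₂ B₃ A₁ : ℝ} {p₀ : ℕ} (R : ChainTδ d M μ ν S γ c ℓ α₂ B₃ A₁ p₀)
    (H : Hyps d γ c ℓ A₁ p₀) :
    ChainVarT d M μ ν S γ (fun g => remActivity (withEps c (deltaOf A₁ p₀ g))) c.κ c.δ₀ α₂ B₃ where
  P1 := R.P1
  beta1_eq := R.beta1_eq
  leaves := fun k p hp => R.leaves118 H k p hp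

/-- The budget of road P2″ is `O(1)·C₃·δ(g)`: non-negative on the box. -/
theorem act_nonneg {γ : ℝ} {c : B13.Consts} {ℓ A₁ : ℝ} {p₀ : ℕ} (H : Hyps d γ c ℓ A₁ p₀) :
    ∀ g, 0 < g → g ≤ γ → 0 ≤ remActivity (withEps c (deltaOf A₁ p₀ g)) := by
  intro g hg hgγ
  rw [remActivity_withEps, mul_assoc]
  exact mul_nonneg H.conds.A₂_nonneg
    (mul_nonneg H.C3_nonneg (deltaOf_nonneg H.A₁_nonneg p₀ hg (hgγ.trans H.gamma_le_one)))

/-- … monotone on the box … -/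
theorem act_monotoneOn {γ : ℝ} {c : B13.Consts} {ℓ A₁ : ℝ} {p₀ : ℕ} (H : Hyps d γ c ℓ A₁ p₀) :
    MonotoneOn (fun g => remActivity (withEps c (deltaOf A₁ p₀ g))) (Ioc 0 γ) := by
  intro g hg g' hg' hgg'
  show remActivity (withEps c (deltaOf A₁ p₀ g)) ≤ remActivity (withEps c (deltaOf A₁ p₀ g'))
  rw [remActivity_withEps, remActivity_withEps]
  exact mul_le_mul_of_nonneg_left (deltaOf_monotoneOn H.A₁_nonneg p₀ H.box hg hg' hgg')
    (mul_nonneg H.conds.A₂_nonneg H.C3_nonneg)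

/-- … and tends to 0 at 0⁺. -/
theorem tendsto_act (c : B13.Consts) (A₁ : ℝ) (p₀ : ℕ) :
    Tendsto (fun g => remActivity (withEps c (deltaOf A₁ p₀ g))) (𝓝[>] (0 : ℝ)) (𝓝 0) := by
  have h := (tendsto_deltaOf A₁ p₀).const_mul (c.A₂ * c.C3act)
  rw [mul_zero] at h
  exact h.congr fun g => (remActivity_withEps c (deltaOf A₁ p₀ g)).symm

/-- Bookkeeping: `A_rem(δ) · K_rem′ = δ · K_rem,L` — this unit's activity-free coefficient `remCoeffVar` times the
substituted activity IS the substituted smallness times the OWNER's fully valued coefficient `remCoeffL`. -/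
theorem act_mul_remCoeffVar (d M : ℕ) (c : B13.Consts) (α₂ B₃ ε : ℝ) :
    remActivity (withEps c ε) * remCoeffVar d M c.κ c.δ₀ α₂ B₃ = ε * remCoeffL d M c α₂ B₃ := by
  rw [remActivity_withEps]
  unfold remCoeffVar modCoeff remCoeffL polConstL deltaL
  ring

/-! ## §4 The ω-form of (D4) on road P2″ with the OWNER's coefficient, and the constant form on the box -/

/-- **THE ω-FORM OF THE REMAINDER BINDER ON ROAD P2″**: for EVERY scale k and EVERY history p ∈ `]0,γ]^{k+1}`,
`|β¹_{k+1}(p)| ≤ δ(g_k) · K_rem,L`, `δ(g) = A₁ g (log g⁻²)^{p₀}`, `K_rem,L = remCoeffL d M c α₂ B₃` THE ROW OWNER'S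
coefficient — the owner's chain (`PolLeavesT.h118` ∘ `decay510` ∘ `abs_secondMoment_le_linear`, through this unit's
`ChainVarT.abs_beta1_le`) read at the substituted constants.  Hypotheses: `Hyps` (§3) and the [I]-side signs α₂ > 0,
B₃ ≥ 0, δ₀ > 0, d > 0.  Compare the owner's `ChainT.abs_beta1_le : RemainderConst S γ (ε₁ · remCoeffL d M c α₂ B₃)`. -/
theorem ChainTδ.abs_beta1_le {M : ℕ} [NeZero M] {μ ν : Fin d} {β : HBeta} {S : B12Beta.OneLoopSplit β} {γ : ℝ}
    {c : B13.Consts} {ℓ α₂ B₃ A₁ : ℝ} {p₀ : ℕ} (R : ChainTδ d M μ ν S γ c ℓ α₂ B₃ A₁ p₀)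
    (H : Hyps d γ c ℓ A₁ p₀) (hα₂ : 0 < α₂) (hB₃ : 0 ≤ B₃) (hδ₀ : 0 < c.δ₀) (hd : 0 < d) :
    RemainderMod S γ (fun g => deltaOf A₁ p₀ g * remCoeffL d M c α₂ B₃) := by
  intro k p hp
  have h := (R.toChainVarT H).abs_beta1_le (act_nonneg H) hα₂ hB₃ hδ₀ H.conds.tree hd k p hp
  simpa only [act_mul_remCoeffVar] using h

/-- `K_rem,L ≥ 0` under `A₂ ≥ 0`, `C₃ ≥ 0`. -/
theorem remCoeffL_nonneg (d M : ℕ) {c : B13.Consts} (hA₂ : 0 ≤ c.A₂) (hC3 : 0 ≤ c.C3act) (α₂ B₃ : ℝ) :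
    0 ≤ remCoeffL d M c α₂ B₃ := by
  unfold remCoeffL B12Sec2to5.betaPrime510
  refine mul_nonneg (mul_nonneg hA₂ hC3) (mul_nonneg (polConstL_nonneg d M c α₂ B₃) (tsum_nonneg fun x => ?_))
  positivity

/-- **THE CONSTANT FORM ON THE BOX**: `RemainderConst S γ (δ(γ) · K_rem,L)` — the owner's conclusion with `ε₁` READ AS
`δ(γ) = A₁γ(log γ⁻²)^{p₀}`, a quantity that → 0 with γ. -/
theorem ChainTδ.remainderConst {M : ℕ} [NeZero M] {μ ν : Fin d} {β : HBeta} {S : B12Beta.OneLoopSplit β} {γ : ℝ}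
    {c : B13.Consts} {ℓ α₂ B₃ A₁ : ℝ} {p₀ : ℕ} (R : ChainTδ d M μ ν S γ c ℓ α₂ B₃ A₁ p₀)
    (H : Hyps d γ c ℓ A₁ p₀) (hα₂ : 0 < α₂) (hB₃ : 0 ≤ B₃) (hδ₀ : 0 < c.δ₀) (hd : 0 < d) :
    RemainderConst S γ (deltaOf A₁ p₀ γ * remCoeffL d M c α₂ B₃) := by
  refine remainderConst_of_mod (R.abs_beta1_le H hα₂ hB₃ hδ₀ hd) ?_
  intro g hg g' hg' hgg'
  exact mul_le_mul_of_nonneg_right (deltaOf_monotoneOn H.A₁_nonneg p₀ H.box hg hg' hgg')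
    (remCoeffL_nonneg d M H.conds.A₂_nonneg H.C3_nonneg α₂ B₃)

/-- **(hr) BY γ, NOT BY ε₁**: for every `b > 0` there is `γ₁ ∈ ]0,γ₀]` with `δ(γ₁) · K_rem,L < b` — where road P1 needs
the inserted restriction N3 `ε₁ · K_rem,L ≤ b·log L` (`RemainderChainTorus.endpointExistence_of_telescope_chainT`,
hypothesis `hε₁`), road P2″ shrinks γ. -/
theorem exists_gamma_threshold (d M : ℕ) {c : B13.Consts} (hA₂ : 0 ≤ c.A₂) (hC3 : 0 ≤ c.C3act) (α₂ B₃ A₁ : ℝ)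
    (p₀ : ℕ) {b γ₀ : ℝ} (hb : 0 < b) (hγ₀ : 0 < γ₀) :
    ∃ γ₁ : ℝ, 0 < γ₁ ∧ γ₁ ≤ γ₀ ∧ deltaOf A₁ p₀ γ₁ * remCoeffL d M c α₂ B₃ < b :=
  exists_threshold (tendsto_deltaOf A₁ p₀) (remCoeffL_nonneg d M hA₂ hC3 α₂ B₃) hb hγ₀

/-! ## §5 The wall END on road P2″ -/

/-- **ROAD P2″ — THE WALL END.**  Binders: `hgen`, the split `S`, a road-P2″ chain `R` on the box `]0,γ₀]` (= the row
owner's torus leaf list at the substituted constants, per scale and history), the hypotheses `Hyps` (ε₁-free numeric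
conditions, R22, signs, `γ₀ ≤ e^{−p₀}`, Kotecký–Preiss smallness at `δ(γ₀)`), the [I]-side signs, the one-loop drift with
constant `b > 0` (rows D1/CAP) and continuity (row hcont).  Conclusion: the wall's `EndpointExistence`.  NO `r ≤ b`
hypothesis, NO N3: `RoadP2Chain.endpointExistence_of_chainVarT` with `hact`/`hmono`/`hA` discharged by §3. -/
theorem endpointExistence_of_chainTδ {M : ℕ} [NeZero M] {C : B12.Construction} {β : HBeta}
    (hgen : ForwardGenerated C β) (S : B12Beta.OneLoopSplit β) {μ ν : Fin d} {γ₀ b Adr : ℝ}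
    {c : B13.Consts} {ℓ α₂ B₃ A₁ : ℝ} {p₀ : ℕ} (R : ChainTδ d M μ ν S γ₀ c ℓ α₂ B₃ A₁ p₀)
    (H : Hyps d γ₀ c ℓ A₁ p₀) (hα₂ : 0 < α₂) (hB₃ : 0 ≤ B₃) (hδ₀ : 0 < c.δ₀) (hd : 0 < d)
    (hγ₀ : 0 < γ₀) (hb : 0 < b) (hdrift : OneLoopDrift b Adr S.β0) (hcont : BetaContH γ₀ β) :
    EndpointExistence C :=
  endpointExistence_of_chainVarT hgen S (R.toChainVarT H) (act_nonneg H) (act_monotoneOn H) (tendsto_act c A₁ p₀)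
    hα₂ hB₃ hδ₀ H.conds.tree hd hγ₀ hb hdrift hcont

/-- **ROAD P2″ IS ROAD P2′ WITH `c_I = c_χ = 0`**: the road-P2″ chain is a gen-1 budget chain
(`RoadP2End.endpointExistence_of_budgetChainT`'s input) with budget `budget 0 (O(1)C₃) 0 λ A₁ p₀` — the cubic insertion
term and the separate cut-off term of [III] (3.30) are simply absent. -/
theorem act_eq_budget (c : B13.Consts) (A₁ lam : ℝ) (p₀ : ℕ) (g : ℝ) :
    remActivity (withEps c (deltaOf A₁ p₀ g)) = budget 0 (c.A₂ * c.C3act) 0 lam A₁ p₀ g := by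
  rw [remActivity_withEps]; unfold deltaOf budget; ring

end

end Summit.QuantumFields.BalabanUV.Beta.VariantCutoffRoad
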